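import Literature.NumberTheory.EllipticCurves.TwoIsogenyTorsor
import Literature.NumberTheory.EllipticCurves.ShaIsogeny
import Literature.NumberTheory.GaloisRepresentations.GaloisCohomologyKummerProofs
import HarnessLib

/-!
# The image of `Ξ : K*/K*² → H¹(K, E)` is `H¹(K, E)[φ]`
# (Silverman, *AEC*, Thm. X.4.2(a): `H¹(G, E[φ]) ↠ WC(E/K)[φ]`)

Sibling proof file of `TwoIsogenyTorsor.lean`. For `V` in two-torsion normal form over a field `K` of
characteristic `0`, `φ = twoIsogenyGeomHom : V(K̄) → V'(K̄)` Silverman's explicit `2`-isogeny and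
`Ξ = twoIsogenyTorsorHom` (`[d] ↦ ξ_d = [σ ↦ χ_d(σ) T]`), this file completes the exactness statements of
*AEC* Thm. X.4.2(a) for `φ` begun there (`ker Ξ = α(V'(K))`) with the exactness at `H¹(K, E)`:

  **`im Ξ = ker (φ_* : H¹(K, V) → H¹(K, V'))`**   (`range_twoIsogenyTorsorHom_eq_ker_galH1Map`),

`φ_* = galH1Map φ` (`ShaIsogeny.lean`). In Silverman's words: the Kummer sequence of `φ` yields
`… → H¹(G, E[φ]) → WC(E/K) →φ WC(E'/K)`, and `H¹(G, E[φ]) = K*/K*²` maps onto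
`WC(E/K)[φ] = ker φ` (X.4.2(a), with X.4.9 for `E[φ] ≅ μ₂`).

* `galH1Map_twoIsogenyTorsorClass` — `φ_* ξ_d = 0` (`φ(T) = O`).
* `twoIsogenyGeomHom_surjective` — `φ : V(K̄) → V'(K̄)` is onto (halving over `K̄`,
  `xSqClass_eq_one_iff_exists`).
* `exists_twoIsogenyTorsorClass_eq_of_galH1Map_eq_zero` — a class `c = [f]` with `φ_* c = 0` is a `ξ_d`:
  `φ ∘ f = ∂(φ P)` so `g = f - ∂P : Γ_K → ker φ = {O, T}` is a continuous homomorphism; the sign cocycle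
  `σ ↦ ±1` is `σ ↦ σβ/β` by Hilbert 90 for locally constant cocycles
  (`absoluteGaloisGroup.exists_eq_smul_div_of_isLocallyConstant_cocycle`, `GaloisCohomologyKummerProofs`),
  `β² = d ∈ K` by Galois descent, and `g = χ_d T`, i.e. `c = ξ_d` — the Kummer-theoretic identification
  `Hom_cont(Γ_K, ℤ/2) = K*/K*²` made explicit.
* `range_twoIsogenyTorsorHom_eq_ker_galH1Map` — `im Ξ = ker φ_*`.
* `natCard_sha_inf_range_twoIsogenyTorsorHom_eq` — over a number field, `#(Ш(V/K) ∩ im Ξ) = #ker Ш(φ)`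
  (`shaMap`), identifying the factor `#(Ш ∩ im Ξ)` of `two_pow_twoIsogenySelmerRank_eq_natCard_mul`
  (`TwoIsogenySelmerGroupSha.lean`) with `#Ш(V/K)[φ]`.

## References

* J. H. Silverman, *The Arithmetic of Elliptic Curves*, 2nd ed., GTM 106 (2009), Thm. X.4.2(a),
  Prop. X.4.9; III.4.5 (the `2`-isogeny). [SilvermanAEC2009]
* J.-P. Serre, *Local Fields*, Ch. X §1 Prop. 2 (Hilbert 90); *Galois Cohomology*, II.§1.2 (Kummer
  theory). [Serre1979]

## Design

Theorems only; same conventions as `TwoIsogenyTorsor.lean` (`K : Type u`, `[CharZero K]`,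
`open scoped Classical`). The local points maps of `φ` enter only the last statement, as a hypothesis
`HasLocalPointsMaps` (discharged in the tree by `hasLocalPointsMaps_twoIsogeny`,
`IsogenyLocalPointsMaps.lean`, not imported here).
-/

noncomputable section

open scoped Classical

universe u

namespace WeierstrassCurve

open Literature.NumberTheory.EllipticCurves Literature.NumberTheory.EllipticCurves.TwoIsogenyTorsor
open Literature.NumberTheory.GaloisRepresentations
open _root_.WeierstrassCurve.Affine (SqUnits sqClass sqClass_mul sqClass_sq sqClass_eq_one_iff sqClass_of_ne_zero)

variable {K : Type u} [Field K] [CharZero K] (V : WeierstrassCurve K) [V.IsTwoTorsionNF] [V.IsElliptic]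

section Image

/-- **`φ_* ξ_d = 0`**: the torsor classes die in `H¹(K, E')` (`φ(T) = O`). [cite: SilvermanAEC2009, Thm. X.4.2(a)] -/
theorem galH1Map_twoIsogenyTorsorClass {d : K} (hd : d ≠ 0) :
    galH1Map V.twoIsogenyGeomHom (twoIsogenyGeomHom_smul V) (V.twoIsogenyTorsorClass hd) = 0 := by
  rw [twoIsogenyTorsorClass, galH1Map_oneCocycleClass, oneCocycleClass_eq_zero_iff]
  refine ⟨0, fun σ => ?_⟩
  rw [contOneCocycles.push_apply, twoIsogenyTorsorCocycle_apply]
  change V.twoIsogenyGeomHom (V.twoIsogenyTorsorFun d σ) = σ • (0 : V.twoIsogenyCodomain.geomPoints) - 0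
  rw [smul_zero, sub_zero, twoIsogenyTorsorFun]
  split_ifs
  · exact map_zero _
  · exact twoIsogenyGeomHom_geomTwoTorsionPoint V

omit [CharZero K] in
/-- Over `K̄` every square class is trivial. [folklore] -/
theorem sqClass_eq_one_of_isAlgClosed {L : Type*} [Field L] [IsAlgClosed L] (a : L) : sqClass a = 1 := by
  by_cases ha : a = 0
  · rw [ha, Affine.sqClass_zero]
  · obtain ⟨z, hz⟩ := IsAlgClosed.exists_eq_mul_self a
    exact (sqClass_eq_one_iff ha).mpr ⟨z, by rw [hz, pow_two]⟩

omit [CharZero K] in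
/-- **`φ : E(K̄) → E'(K̄)` is surjective** (every abscissa is a square over `K̄`: halving,
`xSqClass_eq_one_iff_exists`). Silverman, *AEC*, III.4.10 / X.4 (`0 → E[φ] → E → E' → 0` exact on
`K̄`-points). [folklore] -/
theorem twoIsogenyGeomHom_surjective : Function.Surjective V.twoIsogenyGeomHom := by
  intro Q
  have h := twoIsogenyCodomain_baseChange V (AlgebraicClosure K)
  obtain ⟨P, hP⟩ : ∃ P, (V.baseChange (AlgebraicClosure K)).twoIsogenyFun P =
      (Affine.Point.congrEquiv h).symm Q := by
    refine ((V.baseChange (AlgebraicClosure K)).xSqClass_eq_one_iff_exists _).mp ?_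
    generalize (Affine.Point.congrEquiv h).symm Q = Q'
    rcases Q' with _ | ⟨x, y, hxy⟩
    · rfl
    · by_cases hx : x = 0
      · rw [xSqClass_some_of_eq_zero hxy hx]; exact sqClass_eq_one_of_isAlgClosed _
      · rw [xSqClass_some_of_ne_zero hxy hx]; exact sqClass_eq_one_of_isAlgClosed _
  refine ⟨P, ?_⟩
  change Affine.Point.congrEquiv h ((V.baseChange (AlgebraicClosure K)).twoIsogenyHom P) = Q
  rw [twoIsogenyHom_apply, hP, AddEquiv.apply_symm_apply]

/-- **`H¹(K, E)[φ] ⊆ im Ξ`** (surjectivity of `H¹(G, E[φ]) → WC(E/K)[φ]` in *AEC* X.4.2(a), made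
explicit): a class `c ∈ H¹(K, E)` killed by `φ_*` is a torsor class `ξ_d`. Proof: `φ ∘ f = ∂Q` with
`Q = φ(P)` (`φ` is onto `E'(K̄)`), so `g = f - ∂P` takes values in `ker φ = {O, T}` and is a continuous
homomorphism `Γ_K → {O, T} ≅ {±1}`; by Hilbert 90 (`exists_eq_smul_div_of_isLocallyConstant_cocycle`)
the sign cocycle is `σ ↦ σβ/β`, then `β² = d ∈ K` and `g = χ_d T`, i.e. `c = [g] = ξ_d`.
[cite: SilvermanAEC2009, Thm. X.4.2(a)] -/
theorem exists_twoIsogenyTorsorClass_eq_of_galH1Map_eq_zero (c : V.galH1)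
    (hc : galH1Map V.twoIsogenyGeomHom (twoIsogenyGeomHom_smul V) c = 0) :
    ∃ (d : K) (hd : d ≠ 0), V.twoIsogenyTorsorClass hd = c := by
  obtain ⟨f, rfl⟩ := oneCocycleClass_surjective _ c
  rw [galH1Map_oneCocycleClass, oneCocycleClass_eq_zero_iff] at hc
  obtain ⟨Q, hQ⟩ := hc
  obtain ⟨P, rfl⟩ := V.twoIsogenyGeomHom_surjective Q
  have hQ' : ∀ σ : Field.absoluteGaloisGroup K,
      V.twoIsogenyGeomHom (f.1 σ) = σ • V.twoIsogenyGeomHom P - V.twoIsogenyGeomHom P := fun σ => hQ σ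
  -- `g = f - ∂P` takes values in `{O, T}`
  set g := f - cobCocycle P (continuous_smul_geomPoints V P) with hg
  have hgval : ∀ σ : Field.absoluteGaloisGroup K, g.1 σ = f.1 σ - (σ • P - P) := fun σ => rfl
  have hgker : ∀ σ : Field.absoluteGaloisGroup K, g.1 σ = 0 ∨ g.1 σ = V.geomTwoTorsionPoint := by
    intro σ
    apply (mem_ker_twoIsogenyGeomHom_iff V _).mp
    rw [AddMonoidHom.mem_ker, hgval, map_sub, map_sub, twoIsogenyGeomHom_smul, hQ', sub_self]
  have hclass : oneCocycleClass _ g = oneCocycleClass _ f := by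
    rw [hg, oneCocycleClass_sub, oneCocycleClass_cobCocycle, sub_zero]
  have hT0 : V.geomTwoTorsionPoint ≠ 0 := geomTwoTorsionPoint_ne_zero V
  have hgmul : ∀ σ τ : Field.absoluteGaloisGroup K, g.1 (σ * τ) = g.1 σ + g.1 τ := by
    intro σ τ
    have h2 : g.1 (σ * τ) = g.1 σ + σ • g.1 τ := g.2 σ τ
    rw [h2]
    congr 1
    rcases hgker τ with h | h
    · rw [h, smul_zero]
    · rw [h, smul_geomTwoTorsionPoint]
  -- the sign cocycle
  set s : Field.absoluteGaloisGroup K → AlgebraicClosure K := fun σ => if g.1 σ = 0 then 1 else -1 with hs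
  have hs0 : ∀ σ, s σ ≠ 0 := by
    intro σ; simp only [hs]; split_ifs <;> norm_num
  have hslc : IsLocallyConstant s := by
    have hglc : IsLocallyConstant g.1 := (IsLocallyConstant.iff_continuous g.1).mpr g.1.continuous
    exact hglc.comp (fun x : V.geomPoints => if x = 0 then (1 : AlgebraicClosure K) else -1)
  have hsfix : ∀ σ τ : Field.absoluteGaloisGroup K, σ • s τ = s τ := by
    intro σ τ
    simp only [hs]
    split_ifs
    · exact smul_one σ
    · rw [smul_neg, smul_one]
  have hscoc : ∀ σ τ : Field.absoluteGaloisGroup K, s (σ * τ) = s σ * σ • s τ := by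
    intro σ τ
    rw [hsfix]
    simp only [hs, hgmul]
    rcases hgker σ with h1 | h1 <;> rcases hgker τ with h2 | h2
    · rw [if_pos (by rw [h1, h2, add_zero]), if_pos h1, if_pos h2, mul_one]
    · rw [if_neg (by rw [h1, h2, zero_add]; exact hT0), if_pos h1, if_neg (by rw [h2]; exact hT0), one_mul]
    · rw [if_neg (by rw [h1, h2, add_zero]; exact hT0), if_neg (by rw [h1]; exact hT0), if_pos h2, mul_one]
    · rw [if_pos (by rw [h1, h2, geomTwoTorsionPoint_add_self]), if_neg (by rw [h1]; exact hT0),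
        if_neg (by rw [h2]; exact hT0)]
      norm_num
  obtain ⟨β, hβ0, hβ⟩ :=
    absoluteGaloisGroup.exists_eq_smul_div_of_isLocallyConstant_cocycle K hslc hs0 hscoc
  have hσβ : ∀ σ : Field.absoluteGaloisGroup K, galAut K σ β = s σ * β := by
    intro σ
    change σ • β = s σ * β
    rw [hβ σ, div_mul_cancel₀ _ hβ0]
  have hs2 : ∀ σ, s σ ^ 2 = 1 := by
    intro σ; simp only [hs]; split_ifs <;> norm_num
  -- `β² = d ∈ K`
  have hβ2 : ∀ σ : Field.absoluteGaloisGroup K, galAut K σ (β ^ 2) = β ^ 2 := by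
    intro σ
    rw [map_pow, hσβ, mul_pow, hs2, one_mul]
  obtain ⟨d, hd⟩ := exists_algebraMap_eq_of_forall_galAut hβ2
  have hd0 : d ≠ 0 := by
    rintro rfl
    rw [map_zero, eq_comm] at hd
    exact pow_ne_zero 2 hβ0 hd
  have hroot : geomSqrt K d = β ∨ geomSqrt K d = -β := by
    rw [← mul_self_eq_mul_self_iff, geomSqrt_mul_self, hd, pow_two]
  -- `σ` fixes `√d` iff `g σ = 0`
  have hfix : ∀ σ : Field.absoluteGaloisGroup K, galAut K σ (geomSqrt K d) = geomSqrt K d ↔ g.1 σ = 0 := by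
    intro σ
    have key : galAut K σ β = β ↔ g.1 σ = 0 := by
      rw [hσβ σ]
      constructor
      · intro h
        by_contra hne
        have h1 : s σ = -1 := if_neg hne
        rw [h1] at h
        have : (2 : AlgebraicClosure K) * β = 0 := by linear_combination -h
        exact hβ0 (by simpa using this)
      · intro h
        rw [show s σ = 1 from if_pos h, one_mul]
    rcases hroot with h | h
    · rw [h, key]
    · rw [h, map_neg, neg_inj, key]
  refine ⟨d, hd0, ?_⟩
  rw [twoIsogenyTorsorClass, ← hclass]
  congr 1
  apply Subtype.ext
  ext σ
  rw [twoIsogenyTorsorCocycle_apply, twoIsogenyTorsorFun]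
  by_cases h : galAut K σ (geomSqrt K d) = geomSqrt K d
  · rw [if_pos h]; exact ((hfix σ).mp h).symm
  · rw [if_neg h]
    rcases hgker σ with h0 | hT
    · exact absurd ((hfix σ).mpr h0) h
    · exact hT.symm

/-- **`im Ξ = H¹(K, E)[φ]`** — exactness of `H¹(K, E[φ]) = K*/K*² →Ξ H¹(K, E) →φ_* H¹(K, E')` at
`H¹(K, E)` (Silverman, *AEC*, Thm. X.4.2(a): the Kummer sequence of `φ` gives
`0 → E'(K)/φ(E(K)) → H¹(G, E[φ]) → WC(E/K)[φ] → 0`, `WC(E/K)[φ] = ker (φ : WC(E/K) → WC(E'/K))`).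
[cite: SilvermanAEC2009, Thm. X.4.2(a) and Prop. X.4.9] -/
theorem range_twoIsogenyTorsorHom_eq_ker_galH1Map :
    AddMonoidHom.range (G := Additive (SqUnits K)) V.twoIsogenyTorsorHom =
      (galH1Map V.twoIsogenyGeomHom (twoIsogenyGeomHom_smul V)).ker := by
  ext c
  constructor
  · rintro ⟨x, rfl⟩
    obtain ⟨u, hu⟩ := QuotientGroup.mk_surjective (Additive.toMul x)
    have hx : x = Additive.ofMul (sqClass (u : K)) := by
      rw [sqClass_of_ne_zero u.ne_zero, Units.mk0_val, hu]; rfl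
    rw [hx, AddMonoidHom.mem_ker, twoIsogenyTorsorHom_sqClass V u.ne_zero]
    exact V.galH1Map_twoIsogenyTorsorClass u.ne_zero
  · intro hc
    obtain ⟨d, hd, h⟩ := V.exists_twoIsogenyTorsorClass_eq_of_galH1Map_eq_zero c hc
    exact ⟨Additive.ofMul (sqClass d), by rw [twoIsogenyTorsorHom_sqClass V hd, h]⟩

/-- **`Ш(E/K) ∩ im Ξ = Ш(E/K)[φ]`**: over a number field, the classes of `Ш(V/K)` in the image of
`Ξ` are exactly the kernel of `Ш(φ) : Ш(V/K) → Ш(V'/K)` (`shaMap`, for any choice of local points maps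
of `φ`, e.g. `hasLocalPointsMaps_twoIsogeny`), counted. This identifies the factor `#(Ш ∩ im Ξ)` of
`two_pow_twoIsogenySelmerRank_eq_natCard_mul` with `#Ш(V/K)[φ]` of *AEC* X.4.2(a).
[cite: SilvermanAEC2009, Thm. X.4.2(a)] -/
theorem natCard_sha_inf_range_twoIsogenyTorsorHom_eq [NumberField K]
    (hloc : HasLocalPointsMaps V V.twoIsogenyCodomain V.twoIsogenyGeomHom) :
    Nat.card ↥(V.sha ⊓ AddMonoidHom.range (G := Additive (SqUnits K)) V.twoIsogenyTorsorHom) =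
      Nat.card (shaMap V.twoIsogenyGeomHom (twoIsogenyGeomHom_smul V) hloc).ker := by
  have hmem : ∀ c : V.sha, c ∈ (shaMap V.twoIsogenyGeomHom (twoIsogenyGeomHom_smul V) hloc).ker ↔
      (c : V.galH1) ∈ AddMonoidHom.range (G := Additive (SqUnits K)) V.twoIsogenyTorsorHom := by
    intro c
    rw [range_twoIsogenyTorsorHom_eq_ker_galH1Map, AddMonoidHom.mem_ker, AddMonoidHom.mem_ker,
      ← coe_shaMap_apply V.twoIsogenyGeomHom (twoIsogenyGeomHom_smul V) hloc c]
    exact ⟨fun h => by rw [h]; rfl, fun h => Subtype.ext h⟩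
  refine Nat.card_eq_of_bijective (fun x => ⟨⟨x.1, x.2.1⟩, (hmem _).mpr x.2.2⟩) ⟨?_, ?_⟩
  · intro x y h
    exact Subtype.ext (congrArg (fun z : (shaMap V.twoIsogenyGeomHom (twoIsogenyGeomHom_smul V) hloc).ker =>
      ((z : V.sha) : V.galH1)) h)
  · rintro ⟨c, hc⟩
    exact ⟨⟨(c : V.galH1), c.2, (hmem c).mp hc⟩, rfl⟩

end Image

end WeierstrassCurve
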